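import Summits.QuantumFields.YangMills.Theorems.BalabanUVNodesN16
import Summits.QuantumFields.BalabanUV.T4Continuum.Support.NE3LocalCrudeWEnd
import Summits.QuantumFields.BalabanUV.T4Continuum.Support.NE7EtaBackgroundRefineThresholds
import HarnessLib

/-!
# Route «BalabanUVNodes» (cluster K4 «SpineRates»), Track-A DAG node N16 = spine estimate NE3 — THE ROW's DECL OF RECORD
# `T4EtaRateMin.NE3Shape` GIVEN ITS SLOT: N16's record `NE3EnergyRateWCov` ∧ N07's interface (H3ˢᵘᵖ) ⟹ `NE3Shape` at Bałaban's
# minimiser readings over `sfClass 4 L N ε`, BY NAME (`d = 4`)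

Cell `pub-ymgap`, seat `pub-ymgap-dag-n16-a` (KNIT-BY-NAME, HUMAN RULING D-0062; chair R424 venue; ROSTER-D0062 row n16: «DECL `T4EtaRateMin.NE3Shape`;
record `NE3EnergyWeightedCovShape.NE3EnergyRateWCov` (:85, p338636)»), generation 2.  `bears_on: R4∕N16`.  Filed `--supports stmt-QuantumFields-19182`
(`SpineGivenEndpoint`, K4).  Sequel of `BalabanUVNodesN16` (g0, p408904), which knits the RECORD decl from the in-edge interfaces (N05 ∧ N07 ⟹
`∃ C, NE3EnergyRateWCov 4 (sfClass 4 L N ε) L N b g C s₁ s₂ dom`) and records the row's OTHER column — the abstract Literature root `T4EtaRateMin.NE3Shape`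
— as «recorded without a slot» («would need T-E_w♯ with the SAME `(u, Z)` as the END's output — not available»).  THIS FILE SUPPLIES THAT SLOT.

WHAT `NE3Shape` IS (`Literature/…/T4EtaRateMin.lean`): for a readings carrier `R` (data `R.dom`, scalar reading `R.act k V` and local readings
`R.loc k V x` of the `k`-step run, volume `R.vol`), `NE3Shape R C θ` = `0 ≤ θ < 1` ∧ `ActionRate R C θ` (`|act (k+1) V − act k V| ≤ C·θ^k·vol`) ∧
`LocalRate R C θ` (`|loc (k+1) V x − loc k V x| ≤ C·θ^k`) — the η-RATE of the minimisers in King's consecutive-step form ([King1986] Prop. 3.8 (3.71)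
p. 664, the printed abelian template; NOT printed for Bałaban's minimisers).  The readings here are BAŁABAN's over the genuine small-field class:
`MinimalActionRate.minActReadings 4 (sfClass 4 L N ε) L N dom loc_D` — `act k V = minAct`, the minimal level-`k` Wilson action with datum `V`
([Balaban1985Variational] (5)–(6) p. 278), `vol = N⁴ = |T₁|`, and the local reading (D) `loc_D k V x = A_{B^k({x})}(sel k V)`, the action of a selected
level-`k` minimiser over the plaquettes based in the `k`-fold block of the unit site `x ∈ [0,N)⁴` (NE3 lineage P1, `NE3LocalCrudeWEnd`).  Rate `θ = L⁻¹`.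

THE BRIDGE (§2).  The lineage's local half in reading (D) (`NE3LocalCrudeWEnd.localRate_crudeW_of_energyRateWSup`) consumes the face **T-E_w♯**
`NE3EnergyWeightedSupShape.NE3EnergyRateWSup` = T-E_w + a DECAYING SUP conjunct `‖Z x κ‖ ≤ s·(L⁻¹)^k` INSIDE the `∃ (u, Z)` (its census: sup supplier
«E-SUP module — none proved»).  The NE7 consumer lineage proved exactly this from the COVARIANT face: `NE7EtaRatesD4Cov.norm_dir_le_rate_cov` — on the
period torus the energy budget `L^k·E_w ≤ γ³` and (Lip₁ᶜ) `Λ₁ ≤ l₁³` force `‖Z x κ‖ ≤ 8l₁²γ·θ^{8k}`, `θ⁶ = L⁻¹`, for the SAME `Z`.  Since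
`θ^{8k} ≤ (L⁻¹)^k`: **T-E_w^cov ⟹ T-E_w♯** with the same pair and `s = 8l₁²γ`.  So N16's RECORD feeds the (D)-reading local END, and with the lineage's
ACTION half (`MinimalActionThm1Type.actionRate_sfClass_thm1Type`, route (A)) gives `NE3Shape` (`NE3LocalCrudeWEnd.ne3Shape_crudeW_of_actionRate`).

CONTENT (0 `def`, 0 `sorry`; bookkeeping over landed theorems BY NAME, plus one numeric lemma):
* §1 `thresholds45_four` — thresholds (iv)(v) of the action half at `d = 4` from the ONE numeral `2^91·L^17·t ≤ 1` (companion of the NE7 lineage's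
  `NE7EtaBackgroundRefineThresholds.thresholds_four` = (i)(ii)(iii) and `classRadius_four`).
* §2 `ne3EnergyRateWSup_of_cov`, `exists_ne3EnergyRateWSup_of_cov` — T-E_w^cov ⟹ T-E_w♯ on ANY class family at `d = 4`.
* §3 `hmin_of_leafH3sup_four` — (H∃) «at every level SOME `RegularSup b c` minimiser over `sfClass 4 L N ε`» from N07's interface (H3ˢᵘᵖ) + the data
  class `dom ⊆ sfClass 4 L N ε₁ 0` + numerals (minimisers EXIST by compactness of the finite configuration space —
  `NE7EtaBackgroundRefineThresholds.exists_regular_isMinimiser_thm1Type`, kernel; their regularity is the hypothesis); **`ne3Shape_of_n16`** — THE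
  SLOT: N16's record `NE3EnergyRateWCov 4 (sfClass 4 L N ε) L N b (gradConst 4 c) C Λ₁ Λ₂' dom` ∧ (H3ˢᵘᵖ) ∧ data class ∧ numerals ⟹ a regular selection
  of minimisers EXISTS and for EVERY such selection `∃ C′ ≥ 0, NE3Shape (minActReadings 4 (sfClass 4 L N ε) L N dom loc_D) C′ (L⁻¹)`.
* §4 VACUITY GUARD: `shapeRegime_exists` (the numerals are jointly satisfiable, `t, ε, ε₁ > 0`, below any radius); `flatStratum_subset_sfClass_zero`;
  `ne3Shape_flatStratum` — on the flat stratum `FS_N` of the genuine class every hypothesis of §3 HOLDS (g0's `n16_flatStratum`,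
  `leafH3sup_flatStratum`) and §3 delivers `NE3Shape` there: no binder is vacuous, no ex falso.

HONEST FRAMING.  Typing∕bookkeeping over LANDED theorems by name; nothing of Bałaban's is asserted; `h16` (N16's record = row NE3's spine estimate, NOT
printed, NOT proved — g0 reduces it to [B8] Thm 2 + (1.37) ∘ [B11] Thm 1 at the pairs) and `h3` ([Balaban1985Variational] Thm 1 (8)+(10) p. 279 TYPE)
are HYPOTHESIS SHAPES; the (D) constant is the lineage's CRUDE one (`∝ N⁴`, not volume-uniform); **N16 ∕ NE3 is NOT discharged**; NODE 00 has not
pinned NE3's carriers; one finite four-torus at fixed ε — NOT ℝ⁴, NOT infinite volume, NOT OS, NOT a mass gap, NOT Clay.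
-/

set_option autoImplicit false

open scoped BigOperators Matrix Matrix.Norms.L2Operator
open NormedSpace Finset

namespace Summit.QuantumFields.YangMills.BalabanUVNodes.N16

open Literature.MathematicalPhysics.QuantumFieldTheory.Balaban1983to89
open B7Prop1Explicit B7Prop2Explicit
open T4AveragingDeficitWall hiding Site Plane Plaq Bond
open T4AveragingDeficitWallBoundary (IsPeriodicCfg periodBox)
open T4AveragingDeficitNonAbelian (wallConstNA wallConstNA_nonneg wallConstLoc)
open T4EtaRateMin (Readings ActionRate LocalRate NE3Shape)
open Summit.QuantumFields.BalabanUV.T4Continuum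
open AveragingDeficitPeriodicCounting (IsPeriodicDir)
open AveragingDeficitDualResidual (dualC1 dualC2)
open AveragingDeficitDerivWallProof (wallConst wallConst_nonneg)
open MinimalActionSandwich (IsMinimiser)
open MinimalActionRate (Regular sfClass minActReadings)
open MinimalActionRefine (RegularSup gradConst gradConst_nonneg)
open MinimalActionWitness (flatCfg)
open SkeletonPrecompGrad (gradRem)
open NE3EnergyShapes (residualScale IsUnitarySite IsPeriodicSite dualC1_nonneg dualC2_nonneg)
open NE3EnergyWeightedShapes (energyNormW)
open NE3EnergyWeightedCovShape (NE3EnergyRateWCov)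
open NE3EnergyWeightedSupShape (NE3EnergyRateWSup)
open NE3.LeafIndexSockets (LeafH3sup)
open NE3LocalCrudeWEnd (ne3Shape_crudeW_of_actionRate)
open MinimalActionThm1Type (actionRate_sfClass_thm1Type)
open NE3ShapeCrudeWitness (gradRem_four)
open NE7EtaRatesD4 (energy_budget_of_residualScale)
open NE7EtaRatesD4Cov (norm_dir_le_rate_cov)
open NE7EtaRatesD4CovReg (unitary_periodic_rescale_bavg_of_regular)
open NE7EtaBackgroundRefineThresholds (exists_regular_isMinimiser_thm1Type thresholds_four classRadius_four)
open NE7EtaBackgroundFlatStratum (gaugeAct_flatCfg_mem_sfClass)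

noncomputable section

variable {n : Type*} [Fintype n] [DecidableEq n]

/-! ## §1 Thresholds (iv)(v) of the action half at `d = 4` from ONE numeral -/

omit [Fintype n] [DecidableEq n] in
/-- **THRESHOLDS (iv)(v) AT `d = 4` FROM ONE NUMERAL**: for `L ≥ 1`, `t ≥ 0` and `2^91·L^17·t ≤ 1`, the thresholds (iv) `(K_b + 8K_m·L⁶)·t ≤ 1`
and (v) `(K_c + 36K_m·L⁶)·t ≤ 1` of `MinimalActionThm1Type.actionRate_thm1Type_class` hold at `d = 4` (`gradRem 4 = 3588`; the coefficient polynomials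
have powers `≤ L¹²` and coefficient sums `< 2^77`).  Companion of `NE7EtaBackgroundRefineThresholds.thresholds_four` ((i)(ii)(iii)). [folklore] -/
theorem thresholds45_four {L : ℕ} (hL : 1 ≤ L) {t : ℝ} (ht : 0 ≤ t) (hsmall : (2 : ℝ) ^ 91 * (L : ℝ) ^ 17 * t ≤ 1) :
    ((32 * (4 : ℕ) + 48 * (4 : ℕ) * (L : ℝ) ^ 2 * (2 * ((4 : ℕ) : ℝ) + gradRem (4 : ℕ))
              + 8192 * ((4 : ℕ) : ℝ) ^ 2 * (2 * ((4 : ℕ) : ℝ) + 1) ^ 2 * (L : ℝ) ^ 2)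
            + 8 * (3 * (1280 * (4 : ℕ) * (((4 : ℕ) : ℝ) + 1) ^ 2 * (((4 : ℕ) : ℝ) + 4) ^ 2 * (L : ℝ) ^ 2
            * (32 * (4 : ℕ) + 48 * (4 : ℕ) * (L : ℝ) ^ 2 * (2 * ((4 : ℕ) : ℝ) + gradRem (4 : ℕ))
              + 8192 * ((4 : ℕ) : ℝ) ^ 2 * (2 * ((4 : ℕ) : ℝ) + 1) ^ 2 * (L : ℝ) ^ 2) ^ 2
          + (4 : ℕ) * (((4 : ℕ) : ℝ) + 1) * ((L : ℝ) ^ 3 * (256 * ((4 : ℕ) : ℝ) ^ 2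
              * (32 * (4 : ℕ) + (24 * (4 : ℕ) * (2 * ((4 : ℕ) : ℝ) + gradRem (4 : ℕ)) + 14336 * ((4 : ℕ) : ℝ) ^ 2 * (((4 : ℕ) : ℝ) + 1) ^ 2)
                + 12 * (2 * ((4 : ℕ) : ℝ) + gradRem (4 : ℕ)))
            + 4 * (24 * (4 : ℕ) * (2 * ((4 : ℕ) : ℝ) + gradRem (4 : ℕ)) + 14336 * ((4 : ℕ) : ℝ) ^ 2 * (((4 : ℕ) : ℝ) + 1) ^ 2)
            + 24 * (2 * ((4 : ℕ) : ℝ) + gradRem (4 : ℕ))))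
          + (((4 : ℕ) : ℝ) - 1) ^ 2 * (37 * (((4 : ℕ) : ℝ) - 1) + 5))) * (L : ℝ) ^ ((4 : ℕ) + 2)) * t ≤ 1 ∧
    (((L : ℝ) ^ 3 * (256 * ((4 : ℕ) : ℝ) ^ 2
              * (32 * (4 : ℕ) + (24 * (4 : ℕ) * (2 * ((4 : ℕ) : ℝ) + gradRem (4 : ℕ)) + 14336 * ((4 : ℕ) : ℝ) ^ 2 * (((4 : ℕ) : ℝ) + 1) ^ 2)
                + 12 * (2 * ((4 : ℕ) : ℝ) + gradRem (4 : ℕ)))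
            + 4 * (24 * (4 : ℕ) * (2 * ((4 : ℕ) : ℝ) + gradRem (4 : ℕ)) + 14336 * ((4 : ℕ) : ℝ) ^ 2 * (((4 : ℕ) : ℝ) + 1) ^ 2)
            + 24 * (2 * ((4 : ℕ) : ℝ) + gradRem (4 : ℕ))))
            + 36 * (3 * (1280 * (4 : ℕ) * (((4 : ℕ) : ℝ) + 1) ^ 2 * (((4 : ℕ) : ℝ) + 4) ^ 2 * (L : ℝ) ^ 2
            * (32 * (4 : ℕ) + 48 * (4 : ℕ) * (L : ℝ) ^ 2 * (2 * ((4 : ℕ) : ℝ) + gradRem (4 : ℕ))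
              + 8192 * ((4 : ℕ) : ℝ) ^ 2 * (2 * ((4 : ℕ) : ℝ) + 1) ^ 2 * (L : ℝ) ^ 2) ^ 2
          + (4 : ℕ) * (((4 : ℕ) : ℝ) + 1) * ((L : ℝ) ^ 3 * (256 * ((4 : ℕ) : ℝ) ^ 2
              * (32 * (4 : ℕ) + (24 * (4 : ℕ) * (2 * ((4 : ℕ) : ℝ) + gradRem (4 : ℕ)) + 14336 * ((4 : ℕ) : ℝ) ^ 2 * (((4 : ℕ) : ℝ) + 1) ^ 2)
                + 12 * (2 * ((4 : ℕ) : ℝ) + gradRem (4 : ℕ)))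
            + 4 * (24 * (4 : ℕ) * (2 * ((4 : ℕ) : ℝ) + gradRem (4 : ℕ)) + 14336 * ((4 : ℕ) : ℝ) ^ 2 * (((4 : ℕ) : ℝ) + 1) ^ 2)
            + 24 * (2 * ((4 : ℕ) : ℝ) + gradRem (4 : ℕ))))
          + (((4 : ℕ) : ℝ) - 1) ^ 2 * (37 * (((4 : ℕ) : ℝ) - 1) + 5))) * (L : ℝ) ^ ((4 : ℕ) + 2)) * t ≤ 1 := by
  have hL1 : (1 : ℝ) ≤ L := by exact_mod_cast hL
  have P : ∀ k : ℕ, k ≤ 17 → (L : ℝ) ^ k ≤ (L : ℝ) ^ 17 := fun k hk => pow_le_pow_right₀ hL1 hk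
  have h0 : (1 : ℝ) ≤ (L : ℝ) ^ 17 := one_le_pow₀ hL1
  have h2 := P 2 (by norm_num); have h3 := P 3 (by norm_num); have h6 := P 6 (by norm_num); have h8 := P 8 (by norm_num)
  have h9 := P 9 (by norm_num); have h10 := P 10 (by norm_num); have h12 := P 12 (by norm_num)
  have key : ∀ X : ℝ, X ≤ (2 : ℝ) ^ 91 * (L : ℝ) ^ 17 → X * t ≤ 1 := fun X hX =>
    (mul_le_mul_of_nonneg_right hX ht).trans hsmall
  refine ⟨key _ ?_, key _ ?_⟩
  · have e : (((32 * (4 : ℕ) + 48 * (4 : ℕ) * (L : ℝ) ^ 2 * (2 * ((4 : ℕ) : ℝ) + gradRem (4 : ℕ))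
              + 8192 * ((4 : ℕ) : ℝ) ^ 2 * (2 * ((4 : ℕ) : ℝ) + 1) ^ 2 * (L : ℝ) ^ 2)
            + 8 * (3 * (1280 * (4 : ℕ) * (((4 : ℕ) : ℝ) + 1) ^ 2 * (((4 : ℕ) : ℝ) + 4) ^ 2 * (L : ℝ) ^ 2
            * (32 * (4 : ℕ) + 48 * (4 : ℕ) * (L : ℝ) ^ 2 * (2 * ((4 : ℕ) : ℝ) + gradRem (4 : ℕ))
              + 8192 * ((4 : ℕ) : ℝ) ^ 2 * (2 * ((4 : ℕ) : ℝ) + 1) ^ 2 * (L : ℝ) ^ 2) ^ 2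
          + (4 : ℕ) * (((4 : ℕ) : ℝ) + 1) * ((L : ℝ) ^ 3 * (256 * ((4 : ℕ) : ℝ) ^ 2
              * (32 * (4 : ℕ) + (24 * (4 : ℕ) * (2 * ((4 : ℕ) : ℝ) + gradRem (4 : ℕ)) + 14336 * ((4 : ℕ) : ℝ) ^ 2 * (((4 : ℕ) : ℝ) + 1) ^ 2)
                + 12 * (2 * ((4 : ℕ) : ℝ) + gradRem (4 : ℕ)))
            + 4 * (24 * (4 : ℕ) * (2 * ((4 : ℕ) : ℝ) + gradRem (4 : ℕ)) + 14336 * ((4 : ℕ) : ℝ) ^ 2 * (((4 : ℕ) : ℝ) + 1) ^ 2)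
            + 24 * (2 * ((4 : ℕ) : ℝ) + gradRem (4 : ℕ))))
          + (((4 : ℕ) : ℝ) - 1) ^ 2 * (37 * (((4 : ℕ) : ℝ) - 1) + 5))) * (L : ℝ) ^ ((4 : ℕ) + 2)) : ℝ)
        = 128 + 11307264 * (L : ℝ) ^ 2 + 25056 * (L : ℝ) ^ 6 + 3221225472000 * (L : ℝ) ^ 8 + 12049817656320 * (L : ℝ) ^ 9
          + 569113231491072000 * (L : ℝ) ^ 10 + 25137162321729159168000 * (L : ℝ) ^ 12 := by
      rw [gradRem_four]; push_cast; ring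
    rw [e]
    have : (128 + 11307264 + 25056 + 3221225472000 + 12049817656320 + 569113231491072000 + 25137162321729159168000 : ℝ)
        ≤ (2 : ℝ) ^ 91 := by norm_num
    nlinarith [h0, h2, h6, h8, h9, h10, h12, this]
  · have e : ((((L : ℝ) ^ 3 * (256 * ((4 : ℕ) : ℝ) ^ 2
              * (32 * (4 : ℕ) + (24 * (4 : ℕ) * (2 * ((4 : ℕ) : ℝ) + gradRem (4 : ℕ)) + 14336 * ((4 : ℕ) : ℝ) ^ 2 * (((4 : ℕ) : ℝ) + 1) ^ 2)
                + 12 * (2 * ((4 : ℕ) : ℝ) + gradRem (4 : ℕ)))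
            + 4 * (24 * (4 : ℕ) * (2 * ((4 : ℕ) : ℝ) + gradRem (4 : ℕ)) + 14336 * ((4 : ℕ) : ℝ) ^ 2 * (((4 : ℕ) : ℝ) + 1) ^ 2)
            + 24 * (2 * ((4 : ℕ) : ℝ) + gradRem (4 : ℕ))))
            + 36 * (3 * (1280 * (4 : ℕ) * (((4 : ℕ) : ℝ) + 1) ^ 2 * (((4 : ℕ) : ℝ) + 4) ^ 2 * (L : ℝ) ^ 2
            * (32 * (4 : ℕ) + 48 * (4 : ℕ) * (L : ℝ) ^ 2 * (2 * ((4 : ℕ) : ℝ) + gradRem (4 : ℕ))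
              + 8192 * ((4 : ℕ) : ℝ) ^ 2 * (2 * ((4 : ℕ) : ℝ) + 1) ^ 2 * (L : ℝ) ^ 2) ^ 2
          + (4 : ℕ) * (((4 : ℕ) : ℝ) + 1) * ((L : ℝ) ^ 3 * (256 * ((4 : ℕ) : ℝ) ^ 2
              * (32 * (4 : ℕ) + (24 * (4 : ℕ) * (2 * ((4 : ℕ) : ℝ) + gradRem (4 : ℕ)) + 14336 * ((4 : ℕ) : ℝ) ^ 2 * (((4 : ℕ) : ℝ) + 1) ^ 2)
                + 12 * (2 * ((4 : ℕ) : ℝ) + gradRem (4 : ℕ)))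
            + 4 * (24 * (4 : ℕ) * (2 * ((4 : ℕ) : ℝ) + gradRem (4 : ℕ)) + 14336 * ((4 : ℕ) : ℝ) ^ 2 * (((4 : ℕ) : ℝ) + 1) ^ 2)
            + 24 * (2 * ((4 : ℕ) : ℝ) + gradRem (4 : ℕ))))
          + (((4 : ℕ) : ℝ) - 1) ^ 2 * (37 * (((4 : ℕ) : ℝ) - 1) + 5))) * (L : ℝ) ^ ((4 : ℕ) + 2)) : ℝ)
        = 25103786784 * (L : ℝ) ^ 3 + 112752 * (L : ℝ) ^ 6 + 14495514624000 * (L : ℝ) ^ 8 + 54224179453440 * (L : ℝ) ^ 9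
          + 2561009541709824000 * (L : ℝ) ^ 10 + 113117230447781216256000 * (L : ℝ) ^ 12 := by
      rw [gradRem_four]; push_cast; ring
    rw [e]
    have : (25103786784 + 112752 + 14495514624000 + 54224179453440 + 2561009541709824000 + 113117230447781216256000 : ℝ)
        ≤ (2 : ℝ) ^ 91 := by norm_num
    nlinarith [h0, h3, h6, h8, h9, h10, h12, this]

/-! ## §2 THE BRIDGE: T-E_w^cov ⟹ T-E_w♯ (the decaying sup conjunct from the energy budget + (Lip₁ᶜ), SAME pair `(u, Z)`) -/

/-- **T-E_w^cov ⟹ T-E_w♯ WITH THE SAME PAIR `(u, Z)`** (`d = 4`, any class family `𝒞`; `L ≥ 2`, `N ≥ 1`, `0 ≤ b`, `512·5·8·L²·b ≤ 1`, `0 ≤ g`,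
`0 ≤ C`; letters `γ > 0` with `C·ρ₄ ≤ γ³` (`ρ₄ = wallConst·N²·(√g·dualC2 + 2b²·dualC1)`, the k-free energy budget), `l₁ > 0` with `Λ₁ ≤ l₁³` and
`γ ≤ l₁·N`): the covariant root `NE3EnergyRateWCov 4 𝒞 L N b g C Λ₁ Λ₂' dom` implies `NE3EnergyRateWSup 4 𝒞 L N b g C (8l₁²γ) dom`.  At every pair the
`∃ (u, Z)` of the covariant root is RE-USED: the energy conjunct verbatim, the sup conjunct `‖Z x κ‖ ≤ 8l₁²γ·(L⁻¹)^k` by `NE7EtaRatesD4Cov.norm_dir_le_rate_cov`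
(budget `NE7EtaRatesD4.energy_budget_of_residualScale` + (Lip₁ᶜ) + fit `γ(θ^k)² ≤ l₁N`, `θ⁶ = L⁻¹`) and `θ^{8k} ≤ θ^{6k} = (L⁻¹)^k`. [folklore] -/
theorem ne3EnergyRateWSup_of_cov [Nonempty n] {𝒞 : ℕ → Set (Site 4 → Fin 4 → (Matrix n n ℂ)ˣ)} {L N : ℕ} (hL : 2 ≤ L)
    (hN : 1 ≤ N) {b g C Λ₁ Λ₂' : ℝ} (hb : 0 ≤ b) (hbs : 512 * (4 + 1) * (4 + 4) * (L : ℝ) ^ 2 * b ≤ 1) (hg : 0 ≤ g) (hC : 0 ≤ C)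
    {dom : Set (Site 4 → Fin 4 → (Matrix n n ℂ)ˣ)} (hcov : NE3EnergyRateWCov 4 𝒞 L N b g C Λ₁ Λ₂' dom)
    {γ l₁ : ℝ} (hγ : 0 < γ) (hγ3 : C * (wallConst 4 L * (N : ℝ) ^ 2 * (Real.sqrt g * dualC2 4 L + 2 * b ^ 2 * dualC1 4 L)) ≤ γ ^ 3)
    (hl₁ : 0 < l₁) (hΛl₁ : Λ₁ ≤ l₁ ^ 3) (hγl : γ ≤ l₁ * N) :
    NE3EnergyRateWSup 4 𝒞 L N b g C (8 * l₁ ^ 2 * γ) dom := by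
  have hL1 : 1 ≤ L := by omega
  have hL0 : (0 : ℝ) < L := by exact_mod_cast (show 0 < L by omega)
  obtain ⟨θ, hθ, hθ6⟩ : ∃ θ : ℝ, 0 < θ ∧ θ ^ 6 = ((L : ℝ))⁻¹ :=
    ⟨((L : ℝ)⁻¹) ^ ((1 : ℝ) / 6), Real.rpow_pos_of_pos (inv_pos.mpr hL0) _, by
      rw [← Real.rpow_natCast, ← Real.rpow_mul (inv_nonneg.mpr hL0.le)]; norm_num⟩
  have hθ1 : θ ≤ 1 := by
    have h : θ ^ 6 ≤ 1 := by rw [hθ6]; exact inv_le_one_of_one_le₀ (by exact_mod_cast hL1)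
    exact (pow_le_one_iff_of_nonneg hθ.le (by norm_num)).mp h
  intro k hk V hV UA UB hA hB hreg
  obtain ⟨u, Z, hu, huP, hZ, hZP, hrep, hE, h1, -⟩ := hcov k hk V hV UA UB hA hB hreg
  obtain ⟨hWu, hWP⟩ := unitary_periodic_rescale_bavg_of_regular hL1 hb hbs hreg
  have hEγ : (L : ℝ) ^ k * energyNormW L k (rescale L (bavg L UB)) Z (periodBox (d := 4) (N * L ^ k)) ≤ γ ^ 3 :=
    (energy_budget_of_residualScale hL1 N b hg hC k hE).trans hγ3
  have hfit : γ * (θ ^ k) ^ 2 ≤ l₁ * N := by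
    have hθk : (θ ^ k) ^ 2 ≤ 1 := pow_le_one₀ (pow_nonneg hθ.le k) (pow_le_one₀ hθ.le hθ1)
    calc γ * (θ ^ k) ^ 2 ≤ γ * 1 := mul_le_mul_of_nonneg_left hθk hγ.le
      _ ≤ l₁ * N := by rw [mul_one]; exact hγl
  refine ⟨u, Z, hu, huP, hZ, hZP, hrep, hE, fun x κ => ?_⟩
  have h := norm_dir_le_rate_cov hL hN hk hθ hθ6 hWu hWP hZP hγ hl₁ hΛl₁ hEγ h1 hfit x κ
  have h8 : θ ^ (8 * k) ≤ ((L : ℝ)⁻¹) ^ k := by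
    rw [← hθ6, ← pow_mul]
    exact pow_le_pow_of_le_one hθ.le hθ1 (by omega)
  calc ‖Z x κ‖ ≤ 8 * l₁ ^ 2 * γ * θ ^ (8 * k) := h
    _ ≤ 8 * l₁ ^ 2 * γ * ((L : ℝ)⁻¹) ^ k := mul_le_mul_of_nonneg_left h8 (by positivity)

/-- **T-E_w^cov ⟹ T-E_w♯, LETTER-FREE FORM** (`d = 4`, any class family; `L ≥ 2`, `N ≥ 1`, `0 ≤ b`, `512·5·8·L²·b ≤ 1`, `0 ≤ g`, `0 ≤ C`):
`NE3EnergyRateWCov 4 𝒞 L N b g C Λ₁ Λ₂' dom → ∃ s ≥ 0, NE3EnergyRateWSup 4 𝒞 L N b g C s dom` — §2 with `γ := max 1 (C·ρ₄)`,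
`l₁ := max 1 (max Λ₁ γ)`.  The face the NE3 lineage's (D)-reading local END consumes — its sup conjunct is supplied by N16's record. [folklore] -/
theorem exists_ne3EnergyRateWSup_of_cov [Nonempty n] {𝒞 : ℕ → Set (Site 4 → Fin 4 → (Matrix n n ℂ)ˣ)} {L N : ℕ} (hL : 2 ≤ L)
    (hN : 1 ≤ N) {b g C Λ₁ Λ₂' : ℝ} (hb : 0 ≤ b) (hbs : 512 * (4 + 1) * (4 + 4) * (L : ℝ) ^ 2 * b ≤ 1) (hg : 0 ≤ g) (hC : 0 ≤ C)
    {dom : Set (Site 4 → Fin 4 → (Matrix n n ℂ)ˣ)} (hcov : NE3EnergyRateWCov 4 𝒞 L N b g C Λ₁ Λ₂' dom) :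
    ∃ s : ℝ, 0 ≤ s ∧ NE3EnergyRateWSup 4 𝒞 L N b g C s dom := by
  set ρ : ℝ := C * (wallConst 4 L * (N : ℝ) ^ 2 * (Real.sqrt g * dualC2 4 L + 2 * b ^ 2 * dualC1 4 L)) with hρ
  have hN1 : (1 : ℝ) ≤ N := by exact_mod_cast hN
  have hγ1 : 1 ≤ max 1 ρ := le_max_left _ _
  have hγ0 : 0 < max 1 ρ := lt_of_lt_of_le one_pos hγ1
  have hγ3 : ρ ≤ max 1 ρ ^ 3 := (le_max_right _ _).trans (le_self_pow₀ hγ1 (by norm_num))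
  have hl1 : 1 ≤ max 1 (max Λ₁ (max 1 ρ)) := le_max_left _ _
  have hl0 : 0 < max 1 (max Λ₁ (max 1 ρ)) := lt_of_lt_of_le one_pos hl1
  have hΛl : Λ₁ ≤ max 1 (max Λ₁ (max 1 ρ)) ^ 3 :=
    ((le_max_left _ _).trans (le_max_right _ _)).trans (le_self_pow₀ hl1 (by norm_num))
  have hγl : max 1 ρ ≤ max 1 (max Λ₁ (max 1 ρ)) * N := by
    calc max 1 ρ ≤ max 1 (max Λ₁ (max 1 ρ)) := (le_max_right _ _).trans (le_max_right _ _)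
      _ ≤ max 1 (max Λ₁ (max 1 ρ)) * N := le_mul_of_one_le_right hl0.le hN1
  exact ⟨8 * max 1 (max Λ₁ (max 1 ρ)) ^ 2 * max 1 ρ, by positivity,
    ne3EnergyRateWSup_of_cov hL hN hb hbs hg hC hcov hγ0 (by rw [← hρ]; exact hγ3) hl0 hΛl hγl⟩

/-! ## §3 THE SLOT: N16's record ∧ N07's interface (H3ˢᵘᵖ) ⟹ the row's DECL `NE3Shape` at Bałaban's readings over `sfClass` -/

/-- **(H∃) AT `d = 4` FROM N07's INTERFACE (H3ˢᵘᵖ)** — for `L ≥ 2`, radii `0 ≤ b, c ≤ t` with `2^91·L^17·t ≤ 1` and `2^76·L^12·t ≤ ε`, the compactness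
regime `16·C₀(4)·ε ≤ 3`, `1024·5·8·L²·ε ≤ 1`, the data class `dom ⊆ sfClass 4 L N ε₁ 0` (`ε₁ ≤ 1∕4`, `ε₁ ≤ b`, `4ε₁ ≤ c`) and N07's interface
`LeafH3sup 4 L N ε b c dom` ([Balaban1985Variational] Thm 1 (8)+(10) p. 279 TYPE): every datum has at EVERY level SOME minimiser over `sfClass 4 L N ε`
which is `RegularSup 4 L N b c k` — EXISTENCE by compactness of the finite configuration space (`NE7EtaBackgroundRefineThresholds.exists_regular_isMinimiser_thm1Type`
∘ `thresholds_four` ∘ `classRadius_four`, kernel: Thm 1 (8) existence is NOT a hypothesis here), REGULARITY from (H3ˢᵘᵖ) (levels `≥ 1`) and the data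
class (level `0`). [folklore] -/
theorem hmin_of_leafH3sup_four [Nonempty n] {L N : ℕ} (hL : 2 ≤ L) {b c t ε ε₁ : ℝ} (hb : 0 ≤ b) (hc : 0 ≤ c) (hbt : b ≤ t) (hct : c ≤ t)
    (hsmall : (2 : ℝ) ^ 91 * (L : ℝ) ^ 17 * t ≤ 1) (hεt : (2 : ℝ) ^ 76 * (L : ℝ) ^ 12 * t ≤ ε)
    (hε1 : 16 * C0 4 * ε ≤ 3) (hε2 : 1024 * (4 + 1) * (4 + 4) * (L : ℝ) ^ 2 * ε ≤ 1)
    (hε₁ : ε₁ ≤ 1 / 4) (hε₁b : ε₁ ≤ b) (hε₁c : 4 * ε₁ ≤ c)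
    {dom : Set (Site 4 → Fin 4 → (Matrix n n ℂ)ˣ)} (hdom : dom ⊆ sfClass 4 L N ε₁ 0) (h3 : LeafH3sup 4 L N ε b c dom) :
    ∀ V ∈ dom, ∀ k : ℕ, ∃ U, IsMinimiser 4 (sfClass 4 L N ε) L N k V U ∧ RegularSup 4 L N b c k U := by
  have hL1 : 1 ≤ L := le_trans (by norm_num) hL
  have ht0 : 0 ≤ t := hb.trans hbt
  obtain ⟨hT1, hT2, hT3⟩ := thresholds_four hL1 ht0 hsmall
  have hE := classRadius_four hL1 ht0 hεt
  have hε2' : 1024 * ((4 : ℕ) + 1) * ((4 : ℕ) + 4) * (L : ℝ) ^ 2 * ε ≤ 1 := by simpa using hε2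
  exact exists_regular_isMinimiser_thm1Type (d := 4) (n := n) (by norm_num) hL hb hc hbt hct hT1 hT2 hT3 hE hε1 hε2' hε₁ hε₁b hε₁c
    hdom (fun V hV k U hU => h3 V hV k U hU)

/-- **N16 · THE ROW's DECL OF RECORD `T4EtaRateMin.NE3Shape` FROM N16's RECORD ∧ N07's INTERFACE** (`d = 4`; `L ≥ 2`, `N ≥ 1`; radii `0 ≤ b, c ≤ t`,
ONE numeral `2^91·L^17·t ≤ 1`, class radius `2^76·L^12·t ≤ ε`, compactness regime `16·C₀(4)·ε ≤ 3`, `1024·5·8·L²·ε ≤ 1`; data class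
`dom ⊆ sfClass 4 L N ε₁ 0` with `ε₁ ≤ 1∕4`, `ε₁ ≤ b`, `4ε₁ ≤ c`; `0 ≤ C`).  ASSUME N16's record decl with regularity letters `(b, gradConst 4 c)`:
`h16 : NE3EnergyRateWCov 4 (sfClass 4 L N ε) L N b (gradConst 4 c) C Λ₁ Λ₂' dom` (= `YMDAG.N16 L N ε b (gradConst 4 c) C Λ₁ Λ₂' dom`; g0's §1 derives it
from N05's ∧ N07's interfaces) and N07's interface `h3 : LeafH3sup 4 L N ε b c dom`.  THEN (a) a selection `sel k V` of run-`k` minimisers over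
`sfClass 4 L N ε` with `RegularSup 4 L N b c k (sel k V)` EXISTS for the data of `dom` (`hmin_of_leafH3sup_four` + choice), and (b) for EVERY such
selection the readings carrier of Bałaban's minimal actions with the local reading (D) `loc_D k V x = A_{B^k({x})}(sel k V)` satisfies
`NE3Shape (minActReadings 4 (sfClass 4 L N ε) L N dom loc_D) C′ (L⁻¹)` for some `C′ ≥ 0` — `T4EtaRateMin.NE3Shape` BY NAME with the honest rate
`0 ≤ L⁻¹ < 1`: `|A_{k+1}(V) − A_k(V)| ≤ C′·(L⁻¹)^k·N⁴` and `|loc_D (k+1) V x − loc_D k V x| ≤ C′·(L⁻¹)^k` for all `k`, `V ∈ dom`, `x ∈ [0,N)⁴`.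
`C′ = max C_A K_D^w` of `NE3LocalCrudeWEnd.ne3Shape_crudeW_of_actionRate` (`K_D^w` crude: `∝ N⁴`).  Chain: §2 (T-E_w♯ from `h16`) → that END with the
action half `MinimalActionThm1Type.actionRate_sfClass_thm1Type` ((H∃) `hmin_of_leafH3sup_four`; thresholds `thresholds_four`, `thresholds45_four`,
`classRadius_four`).  N16 ∕ NE3 is NOT proved: `h16` and `h3` are the hypotheses. [folklore] -/
theorem ne3Shape_of_n16 [Nonempty n] {L N : ℕ} (hL : 2 ≤ L) (hN : 1 ≤ N) {ε ε₁ b c t C Λ₁ Λ₂' : ℝ}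
    (hb : 0 ≤ b) (hc : 0 ≤ c) (hbt : b ≤ t) (hct : c ≤ t) (hC : 0 ≤ C)
    (hsmall : (2 : ℝ) ^ 91 * (L : ℝ) ^ 17 * t ≤ 1) (hεt : (2 : ℝ) ^ 76 * (L : ℝ) ^ 12 * t ≤ ε)
    (hε1 : 16 * C0 4 * ε ≤ 3) (hε2 : 1024 * (4 + 1) * (4 + 4) * (L : ℝ) ^ 2 * ε ≤ 1)
    (hε₁ : ε₁ ≤ 1 / 4) (hε₁b : ε₁ ≤ b) (hε₁c : 4 * ε₁ ≤ c)
    {dom : Set (Site 4 → Fin 4 → (Matrix n n ℂ)ˣ)} (hdom : dom ⊆ sfClass 4 L N ε₁ 0)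
    (h16 : NE3EnergyRateWCov 4 (sfClass 4 L N ε) L N b (gradConst 4 c) C Λ₁ Λ₂' dom)
    (h3 : LeafH3sup 4 L N ε b c dom) :
    (∃ sel : ℕ → (Site 4 → Fin 4 → (Matrix n n ℂ)ˣ) → (Site 4 → Fin 4 → (Matrix n n ℂ)ˣ),
        ∀ V ∈ dom, ∀ k : ℕ, IsMinimiser 4 (sfClass 4 L N ε) L N k V (sel k V) ∧ RegularSup 4 L N b c k (sel k V)) ∧
    ∀ sel : ℕ → (Site 4 → Fin 4 → (Matrix n n ℂ)ˣ) → (Site 4 → Fin 4 → (Matrix n n ℂ)ˣ),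
      (∀ V ∈ dom, ∀ k : ℕ, IsMinimiser 4 (sfClass 4 L N ε) L N k V (sel k V)) →
      (∀ V ∈ dom, ∀ k : ℕ, RegularSup 4 L N b c k (sel k V)) →
      ∃ C' : ℝ, 0 ≤ C' ∧
        NE3Shape
          (minActReadings 4 (sfClass 4 L N ε) L N dom
            (fun k V (x : ↥(periodBox (d := 4) N)) =>
              fineAction (sel k V) (((blockSites L)^[k] {(x : Site 4)}) ×ˢ Finset.univ)))
          C' ((L : ℝ)⁻¹) := by
  classical
  have hL1 : 1 ≤ L := le_trans (by norm_num) hL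
  have ht0 : 0 ≤ t := hb.trans hbt
  have hmin := hmin_of_leafH3sup_four hL hb hc hbt hct hsmall hεt hε1 hε2 hε₁ hε₁b hε₁c hdom h3
  refine ⟨?_, fun sel hsel hreg => ?_⟩
  · -- (a) a regular selection by choice
    refine ⟨fun k V => if h : V ∈ dom then Classical.choose (hmin V h k) else V, fun V hV k => ?_⟩
    simp only [dif_pos hV]
    exact Classical.choose_spec (hmin V hV k)
  · -- (b) the thresholds of the action half at `d = 4`
    obtain ⟨hT1, hT2, hT3⟩ := thresholds_four hL1 ht0 hsmall
    obtain ⟨hT4, hT5⟩ := thresholds45_four hL1 ht0 hsmall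
    have hE := classRadius_four hL1 ht0 hεt
    -- the k-free averaging condition on `b` from threshold (ii): `52428800·L²·t ≤ 1`
    have hbs : 512 * (4 + 1) * (4 + 4) * (L : ℝ) ^ 2 * b ≤ 1 := by
      have e : (2 : ℝ) ^ 15 * (((4 : ℕ) : ℝ) + 1) ^ 2 * (((4 : ℕ) : ℝ) + 4) ^ 2 * (L : ℝ) ^ 2 * t = 52428800 * ((L : ℝ) ^ 2 * t) := by
        push_cast; ring
      have h2 : 52428800 * ((L : ℝ) ^ 2 * t) ≤ 1 := by rw [← e]; exact hT2
      have hL2 : (0 : ℝ) ≤ (L : ℝ) ^ 2 := by positivity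
      have h3' : (L : ℝ) ^ 2 * b ≤ (L : ℝ) ^ 2 * t := mul_le_mul_of_nonneg_left hbt hL2
      have h4 : 0 ≤ (L : ℝ) ^ 2 * b := mul_nonneg hL2 hb
      nlinarith
    have hbs' : 20480 * (L : ℝ) ^ 2 * b ≤ 1 := by convert hbs using 1; ring
    -- T-E_w♯ from N16's record (§2)
    obtain ⟨s, hs, hTE⟩ := exists_ne3EnergyRateWSup_of_cov hL hN hb hbs (gradConst_nonneg (d := 4) c) hC h16
    -- the action half, route (A), for the (D)-reading of this selection
    have hA := actionRate_sfClass_thm1Type (d := 4) (n := n) (by norm_num) hL1 hN hb hc hbt hct hT1 hT2 hT3 hT4 hT5 hE hmin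
      (fun k V (x : ↥(periodBox (d := 4) N)) => fineAction (sel k V) (((blockSites L)^[k] {(x : Site 4)}) ×ˢ Finset.univ))
    have hCA : 0 ≤ wallConstNA 4 L * (gradConst 4 1 + 1) / (L : ℝ) ^ 2 := by
      have := wallConstNA_nonneg (d := 4) L
      have := gradConst_nonneg (d := 4) (1 : ℝ)
      positivity
    exact ⟨_, le_trans hCA (le_max_left _ _), ne3Shape_crudeW_of_actionRate hL hN hb hc hC hs hbs' hTE hsel hreg hCA hA⟩

/-! ## §4 VACUITY GUARD: the numerals are satisfiable; on the flat stratum every hypothesis of §3 holds and §3 yields `NE3Shape` there -/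

omit [Fintype n] [DecidableEq n] in
/-- **THE NUMERIC REGIME OF §3 IS INHABITED BELOW EVERY RADIUS** (`L ≥ 1`, any `r > 0`): there are `ε, t, ε₁ > 0` with `ε ≤ r`, `2^91·L^17·t ≤ 1`,
`2^76·L^12·t ≤ ε`, `16·C₀(4)·ε ≤ 3`, `1024·5·8·L²·ε ≤ 1`, `ε₁ ≤ 1∕4`, `ε₁ ≤ t`, `4ε₁ ≤ t`, `t ≤ ε∕2` (take `b = c = t`).  Elementary. [folklore] -/
theorem shapeRegime_exists {L : ℕ} (hL : 1 ≤ L) {r : ℝ} (hr : 0 < r) :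
    ∃ ε t ε₁ : ℝ, 0 < ε ∧ ε ≤ r ∧ 0 < t ∧ 0 < ε₁ ∧
      (2 : ℝ) ^ 91 * (L : ℝ) ^ 17 * t ≤ 1 ∧ (2 : ℝ) ^ 76 * (L : ℝ) ^ 12 * t ≤ ε ∧
      16 * C0 4 * ε ≤ 3 ∧ 1024 * (4 + 1) * (4 + 4) * (L : ℝ) ^ 2 * ε ≤ 1 ∧
      ε₁ ≤ 1 / 4 ∧ ε₁ ≤ t ∧ 4 * ε₁ ≤ t ∧ t ≤ ε / 2 := by
  have hL0 : (0 : ℝ) < L := by exact_mod_cast (show 0 < L by omega)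
  have hC0 : 0 < C0 4 := by unfold C0; positivity
  -- the class radius
  set ε : ℝ := min r (min (3 / (16 * C0 4)) (1 / (1024 * (4 + 1) * (4 + 4) * (L : ℝ) ^ 2))) with hεdef
  have hε0 : 0 < ε := lt_min hr (lt_min (by positivity) (by positivity))
  have hεr : ε ≤ r := min_le_left _ _
  have hε1 : 16 * C0 4 * ε ≤ 3 := by
    have h : ε ≤ 3 / (16 * C0 4) := (min_le_right _ _).trans (min_le_left _ _)
    rw [le_div_iff₀ (by positivity)] at h; linarith
  have hε2 : 1024 * (4 + 1) * (4 + 4) * (L : ℝ) ^ 2 * ε ≤ 1 := by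
    have h : ε ≤ 1 / (1024 * (4 + 1) * (4 + 4) * (L : ℝ) ^ 2) := (min_le_right _ _).trans (min_le_right _ _)
    rw [le_div_iff₀ (by positivity)] at h; linarith
  -- the radius `t`
  set t : ℝ := min (ε / 2) (min (1 / ((2 : ℝ) ^ 91 * (L : ℝ) ^ 17)) (ε / ((2 : ℝ) ^ 76 * (L : ℝ) ^ 12))) with htdef
  have ht0 : 0 < t := lt_min (by positivity) (lt_min (by positivity) (by positivity))
  have htε : t ≤ ε / 2 := min_le_left _ _
  have ht1 : (2 : ℝ) ^ 91 * (L : ℝ) ^ 17 * t ≤ 1 := by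
    have h : t ≤ 1 / ((2 : ℝ) ^ 91 * (L : ℝ) ^ 17) := (min_le_right _ _).trans (min_le_left _ _)
    rw [le_div_iff₀ (by positivity)] at h; linarith
  have ht2 : (2 : ℝ) ^ 76 * (L : ℝ) ^ 12 * t ≤ ε := by
    have h : t ≤ ε / ((2 : ℝ) ^ 76 * (L : ℝ) ^ 12) := (min_le_right _ _).trans (min_le_right _ _)
    rw [le_div_iff₀ (by positivity)] at h; linarith
  refine ⟨ε, t, min (1 / 4) (t / 4), hε0, hεr, ht0, lt_min (by norm_num) (by positivity), ht1, ht2, hε1, hε2, min_le_left _ _, ?_, ?_, htε⟩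
  · exact (min_le_right _ _).trans (by linarith)
  · have := min_le_right (1 / 4 : ℝ) (t / 4); linarith

/-- **THE FLAT STRATUM LIES IN THE DATA CLASS**: every `N`-periodic pure gauge `1^{w}` (`w` unitary) is in `sfClass 4 L N ε₁ 0` for every `ε₁ ≥ 0`
(unitary, `N`-periodic, plaquettes `1`; `NE7EtaBackgroundFlatStratum.gaugeAct_flatCfg_mem_sfClass`). [folklore] -/
theorem flatStratum_subset_sfClass_zero [Nonempty n] (L N : ℕ) {ε₁ : ℝ} (hε₁ : 0 ≤ ε₁) :
    {v : Site 4 → Fin 4 → (Matrix n n ℂ)ˣ | IsPeriodicCfg v (N : ℤ) ∧ ∃ w : Site 4 → (Matrix n n ℂ)ˣ,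
        IsUnitarySite w ∧ v = gaugeAct w flatCfg} ⊆ sfClass 4 L N ε₁ 0 := by
  rintro v ⟨hvP, w, hwu, rfl⟩
  refine gaugeAct_flatCfg_mem_sfClass hε₁ hwu ?_
  simpa using hvP

/-- **NO BINDER OF §3 IS VACUOUS — `NE3Shape` ON THE FLAT STRATUM, THROUGH §3** (`L ≥ 2`, `N ≥ 1`; the numerals of §3 with `0 ≤ ε₁`; `0 ≤ C, Λ₁, Λ₂′`):
on the flat stratum `FS_N = {v N-periodic | ∃ w unitary, v = 1^{w}}` of the genuine class `sfClass 4 L N ε` the data class holds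
(`flatStratum_subset_sfClass_zero`), N16's record holds (g0's `n16_flatStratum`, `Z = 0`) and N07's interface holds (g0's `leafH3sup_flatStratum`), so
§3 APPLIES there; with `shapeRegime_exists` (numerals inhabited, `t > 0`) the hypothesis set of `ne3Shape_of_n16` is jointly satisfiable on ONE class
family with a NON-EMPTY datum set (`1 ∈ FS_N`, g0's `inEdges_inhabited_flatStratum`). [folklore] -/
theorem ne3Shape_flatStratum [Nonempty n] {L N : ℕ} (hL : 2 ≤ L) (hN : 1 ≤ N) {ε ε₁ b c t C Λ₁ Λ₂' : ℝ}
    (hb : 0 ≤ b) (hc : 0 ≤ c) (hbt : b ≤ t) (hct : c ≤ t) (hC : 0 ≤ C) (hΛ₁ : 0 ≤ Λ₁) (hΛ₂' : 0 ≤ Λ₂')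
    (hsmall : (2 : ℝ) ^ 91 * (L : ℝ) ^ 17 * t ≤ 1) (hεt : (2 : ℝ) ^ 76 * (L : ℝ) ^ 12 * t ≤ ε)
    (hε1 : 16 * C0 4 * ε ≤ 3) (hε2 : 1024 * (4 + 1) * (4 + 4) * (L : ℝ) ^ 2 * ε ≤ 1)
    (hε₁0 : 0 ≤ ε₁) (hε₁ : ε₁ ≤ 1 / 4) (hε₁b : ε₁ ≤ b) (hε₁c : 4 * ε₁ ≤ c) :
    (∃ sel : ℕ → (Site 4 → Fin 4 → (Matrix n n ℂ)ˣ) → (Site 4 → Fin 4 → (Matrix n n ℂ)ˣ),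
        ∀ V ∈ {v : Site 4 → Fin 4 → (Matrix n n ℂ)ˣ | IsPeriodicCfg v (N : ℤ) ∧ ∃ w : Site 4 → (Matrix n n ℂ)ˣ,
            IsUnitarySite w ∧ v = gaugeAct w flatCfg},
          ∀ k : ℕ, IsMinimiser 4 (sfClass 4 L N ε) L N k V (sel k V) ∧ RegularSup 4 L N b c k (sel k V)) ∧
    ∀ sel : ℕ → (Site 4 → Fin 4 → (Matrix n n ℂ)ˣ) → (Site 4 → Fin 4 → (Matrix n n ℂ)ˣ),
      (∀ V ∈ {v : Site 4 → Fin 4 → (Matrix n n ℂ)ˣ | IsPeriodicCfg v (N : ℤ) ∧ ∃ w : Site 4 → (Matrix n n ℂ)ˣ,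
          IsUnitarySite w ∧ v = gaugeAct w flatCfg}, ∀ k : ℕ, IsMinimiser 4 (sfClass 4 L N ε) L N k V (sel k V)) →
      (∀ V ∈ {v : Site 4 → Fin 4 → (Matrix n n ℂ)ˣ | IsPeriodicCfg v (N : ℤ) ∧ ∃ w : Site 4 → (Matrix n n ℂ)ˣ,
          IsUnitarySite w ∧ v = gaugeAct w flatCfg}, ∀ k : ℕ, RegularSup 4 L N b c k (sel k V)) →
      ∃ C' : ℝ, 0 ≤ C' ∧
        NE3Shape
          (minActReadings 4 (sfClass 4 L N ε) L N
            {v : Site 4 → Fin 4 → (Matrix n n ℂ)ˣ | IsPeriodicCfg v (N : ℤ) ∧ ∃ w : Site 4 → (Matrix n n ℂ)ˣ,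
              IsUnitarySite w ∧ v = gaugeAct w flatCfg}
            (fun k V (x : ↥(periodBox (d := 4) N)) =>
              fineAction (sel k V) (((blockSites L)^[k] {(x : Site 4)}) ×ˢ Finset.univ)))
          C' ((L : ℝ)⁻¹) := by
  have hL1 : 1 ≤ L := le_trans (by norm_num) hL
  have ht0 : 0 ≤ t := hb.trans hbt
  have hε0 : 0 ≤ ε := le_trans (by positivity) hεt
  exact ne3Shape_of_n16 hL hN hb hc hbt hct hC hsmall hεt hε1 hε2 hε₁ hε₁b hε₁c (flatStratum_subset_sfClass_zero L N hε₁0)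
    (n16_flatStratum hL1 hN hε0 b (gradConst 4 c) hC hΛ₁ hΛ₂') (leafH3sup_flatStratum hL1 hN hε0 hb hc)

end

end Summit.QuantumFields.YangMills.BalabanUVNodes.N16
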